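import Summits.BirchSwinnertonDyer.BirchSwinnertonDyer.Theses.CycTangentCM
import Literature.NumberTheory.EllipticCurves.PAdicLFunctionFunctionalEquationProofs
import Summits.BirchSwinnertonDyer.BirchSwinnertonDyer.Theorems.CycTangentCMCycTangentBoundStubLowContact
import Summits.BirchSwinnertonDyer.BirchSwinnertonDyer.Theorems.CycTangentCMCycTangentBoundFrameSignOfSelfDual
import HarnessLib

set_option linter.dupNamespace false
set_option autoImplicit false

/-!
# LINE `tangent-cone-parity` on crux `CycTangentCM.CycTangentBound` (stmt-BirchSwinnertonDyer-22628)
(route `CycTangentCM`, K6 leaf `BSDpOnClassX9`; lead prover seat `bsd-line-ctcm-p1` g0; D-0145 LINE-FIRST skeleton)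

**Target by name.** `Summit.BirchSwinnertonDyer.BirchSwinnertonDyer.Theses.CycTangentCM.CycTangentBound`: in every
`ψ⁻¹`-twisted two-variable Katz–de Shalit frame `G ∈ 𝒪_{ℂ_p}⟦T₁⟧⟦T₂⟧` (`IsKatzMeasure₂`, outer `T₁ ↔ γ₁`, inner
`T₂ ↔ γ₂` with `κ₂` CYCLOTOMIC, so the inner line `T₁ = 0`, `PowerSeries.constantCoeff G = G(0,T₂)`, is the cyclotomic
line = unit · `L_p(A)` by Rubin §12) of a maximal-CM anchor curve `A/ℚ` at a good ordinary `p ≥ 5`: a unit coefficient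
`[T₁^i T₂^j]G` forces a unit coefficient of `G(0,T₂)` in degree `≤ i+j+1` («`λ̄_cyc ≤ m₀ + 1`»).

**Reading of the crux (this seat).** With `Ḡ ∈ 𝔽̄_p⟦T₁,T₂⟧` the reduction, `m₀ = ord Ḡ`, `λ̄ = ord Ḡ(0,T₂)`
(`= λ(L_p(A))` granted `μ = 0`), the crux is `λ̄ ≤ m₀ + 1`.  The lever of the route (complex conjugation ∘ de Shalit
II.6.4) gives, after the `1`-unit cocycle is normalised away (`p` odd), `Ḡ(T₁, σT₂) = ε·Ḡ` with `σ` acting as `−1`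
on the cyclotomic cotangent direction and `ε = ±1` the sign: `Ḡ` is EVEN or ODD in a cyclotomic coordinate `u`
(`σu = −u`).  Consequences: `λ̄ ≡ (1−ε)/2 (mod 2)`; CTB ⟺ the coefficient of `u^{m₀}` or `u^{m₀+1}` (the one of the
right parity) of `Ḡ(0,u)` is non-zero; and — the content of this skeleton — CTB is AUTOMATIC whenever `λ̄ ≤ 3`
(`λ̄ = 2 ⟹ c̄₀₀ = 0 ⟹ m₀ ≥ 1`; `λ̄ = 3 ⟹ ε = −1 ⟹ c̄₁₀ = −c̄₁₀ = 0`, and `c̄₀₀ = c̄₀₁ = 0`, so `m₀ ≥ 2`).  Hence the crux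
can fail only at pairs `(A, p)` with `λ(L_p(A)) ≥ 4`; there parity gives nothing (e.g. even case `λ̄ = 4` needs
`c̄₁₀ = c̄₂₀ = 0`, two conditions off the line with no known mechanism) — that residue is `stub_higherContact`, the
OPEN content of the crux (R2 «HigherContact» of the route's two-layer plan), isolated by name.

**Stubs (v3/v4).** [v4 note 2026-08-28T00:00Z: `stub_selfDual` is now EXACTLY an instance of the cite-only Literature fact
`DeShalit1987.thmII64_selfDual_functionalEquation_cm` (p585725, -p2) and the conditional closer
`Theorems.CycTangentCMCycTangentBoundOfFacts.cycTangentBound_of_selfDualFact_of_higherContact` (p587567, -p1) certifies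
CTB ⟸ that fact ∧ `stub_higherContact`; the crux therefore stands CLOSED MODULO {one printed theorem, the open
higher-contact statement}.] `stub_selfDual` (number theory: the self-dual pointwise functional equation of the ψ⁻¹-frame,
dS II.6.4–6.5 + self-duality + frame uniqueness; -p2 reduced R1 to exactly this, p581714/p583714/p584491/p585046);
`stub_frameSign` (PROVED from `stub_selfDual`; formerly the number-theory stub; = the route's rung R1 «TangentSymmetry» in the form the algebra consumes:
the sign `ε`, the one-variable functional equation of the reduced inner line, and its first-order companion off the
line; inputs in print: de Shalit 1987 II.6.4 (tree fact `DeShalit1987.thmII64_katzMeasure₂_functionalEquation`,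
cite-only), self-duality `(ψ_A⁻¹)̌ = ψ_A⁻¹` for `A/ℚ`, two-variable rigidity (values on the tower ⟹ series), or — for
the line part alone — Rubin §12 (`Rubin1991.sec12_padicLFunction_eq_unit_mul_cyclotomicLine`, route item
KatzFrameInputs) + the tree's PROVED functional equation of `L_p(f_A, α)` (`subst_padicLFunction_eq_of_symmetry`));
`stub_lowContact` (pure algebra over any local ring with `2` a unit — PROVED by this seat, landed as
`Theorems/CycTangentCMCycTangentBoundStubLowContact.lean`); `stub_higherContact` (the crux restricted to frames whose
inner line has no unit coefficient in degree `≤ 3`: OPEN, crux-sized).  Composition `CycTangentBound_of`: case split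
on `∃ n ≤ 3, IsUnit [T₂ⁿ]G(0,T₂)`.

**Faithfulness audit (this seat, NOTES.md §audit).** No typing artefact decides the crux: `IsKatzMeasure₂` quantifies
over `hL : LFunction.HasEntireContinuation (heckeLFunction (ψ⁻¹ρ))` (a `Prop`, `continuation` by `choose`, agreement on
`re s > 1` where the Euler product of the type-`(−m, j)` character converges), so `G` is pinned exactly as in print and
no junk `G` is certifiable; `IsCMFieldOfJ`, `hι`, the period and modulus clauses are the tree's standard frame.  The
crux is open mathematics modulo the cite-only frame facts; `¬`CTB is not constructible in the tree (frames need
Deuring + de Shalit II.4.17).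

**Cheapest falsifier (sharpened).** A maximal-CM `A/ℚ` (ANY twist: the crux quantifies over all `A` with
`A.j ∈ maximalCMJInvariants`) and split ordinary `p ≥ 5`, `A[p]` irreducible, with `λ(L_p(A)) ≥ 4` AND a second
`ℤ_p`-line `ℓ` through `ψ⁻¹` with `λ̄(ℓ) ≤ λ(L_p(A)) − 2` (`m₀ ≤ λ̄(ℓ)` for every line): e.g. rank-0 sextic twists
`y² = x³ + k` at the anomalous prime `p = 7` (`a_7 = 1`, `k ≡ 5 mod 7`) with `λ_7 = 4`, against `λ` of the
anticyclotomic (BDP) or Katz `𝔭`-power branch.  Rows with `λ_p ≤ 3` (all 149 rows of the ideator's CM-λ-table v1,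
j291624) can never kill the crux — by `stub_lowContact`, not merely «by raising `m₀`».

**bears_on.** K6 crux stmt-19234 `MuZeroCMCurves` via route item 22637 `Assembly`; BSD is not proved by any of this.
-/

noncomputable section

open scoped Classical
open PowerSeries NumberField IsDedekindDomain Field
open Literature.NumberTheory.EllipticCurves Literature.NumberTheory.GaloisRepresentations

namespace Summit.BirchSwinnertonDyer.BirchSwinnertonDyer.Cruxes.CycTangentBound.TangentConeParity

/-- **stub `stub_selfDual` — the SELF-DUAL POINTWISE FUNCTIONAL EQUATION of the `ψ_A⁻¹`-frame (the one
arithmetic input of rung R1, v3 reshape after -p2's reduction p585046).**  In the setting of the crux: there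
are a sign `w = ±1` and `g ∈ Γ_K` such that for all continuous characters `r, r₂` through the pair that are
conjugate-inverse to each other (`IsConjInverse`), `G(P(r)) = w · r(g) · G(P(r₂))` (as `HasValueAt₂`
statements) — de Shalit 1987 II.6.4 Theorem (i) (9)/(15) in the typed shape of
`DeShalit1987.thmII64_katzMeasure₂_functionalEquation` (cite-only in the tree) with the reflected frame `Ǧ`
EQUAL to `G` and the unit `C` EQUAL to `±1`: on the branch of `ψ_A⁻¹` for a CM curve `A/ℚ` one has
`(ψ_A⁻¹)̌ = ψ_A⁻¹` (`ψ_A(𝔞̄) = ψ̄_A(𝔞)`, Deuring clause (ii) `IsHeckeConjEquivariant`; `ψψ̄ = N`), `c • S = S`,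
so `Ǧ` is a frame for the same data and equals `G` by uniqueness of the two-variable measure on the typed
range; `C = sgn(ψ⁻¹) = W^{padic}(ψ⁻¹)ψ⁻¹(σ_{−1}) = ±1` (II.6.5 (18)).  NOT in the tree: needs the cite-only
fact `thmII64`, the self-duality, and frame uniqueness (rigidity over the typed interpolation range — the
interpolation characters exist by `…PairSupply`, p584708, the identity principle by p580670); or (SD) as
its own cited fact.  Size L. [deShalit1987 II.6.4 (9), (13)–(15), II.6.5 (18); SilvermanATAEC1994 II.10.5] -/
theorem stub_selfDual
    (A : WeierstrassCurve ℚ) [A.IsElliptic] [A.IsGloballyMinimal] (p : ℕ) [Fact p.Prime]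
    (hp : 5 ≤ p) (hj : A.j ∈ maximalCMJInvariants) (hgood : A.HasGoodReductionAtPrime p)
    (hord : ¬ (p : ℤ) ∣ A.frobeniusTrace p) (hirr : A.HasIrreducibleModPGaloisRep p)
    (K : Type) [Field K] [NumberField K] (hK : IsCMFieldOfJ K A.j)
    (ψ : HeckeCharacter K) (hψ : ψ.HasInfinityType (fun _ ↦ 1) (fun _ ↦ 0))
    (hL : ∀ s : ℂ, 3 / 2 < s.re → heckeLFunction ψ s = A.LSeries s)
    (ι : PadicAlgCl p ≃+* ℂ) (v vbar : HeightOneSpectrum (𝓞 K))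
    (hv : ((p : ℕ) : 𝓞 K) ∈ v.asIdeal) (hvbar : ((p : ℕ) : 𝓞 K) ∈ vbar.asIdeal) (hne : vbar ≠ v)
    (hι : ∀ (w : InfinitePlace K) (k : 𝓞 K), k ∈ v.asIdeal ↔ ‖ι.symm (w.embedding (k : K))‖ < 1)
    (S : Finset (HeightOneSpectrum (𝓞 K))) (hvS : v ∉ S) (hvbS : vbar ∉ S)
    (hSram : ∀ w ∈ S, ¬ ψ.IsUnramifiedAt w)
    (hSunr : ∀ w : HeightOneSpectrum (𝓞 K), w ∉ S → ψ.IsUnramifiedAt w)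
    (κ₁ κ₂ : ZpExtension K p) (γ₁ γ₂ : absoluteGaloisGroup K)
    (hpair : ZpExtension.IsTopGeneratorPair κ₁ κ₂ γ₁ γ₂) (hcyc : κ₂.IsCyclotomic)
    (hγ₂ : ∃ ζ : ℤ_[p]ˣ, IsOfFinOrder ζ ∧
        ((GaloisRep.cyclotomicCharacter K p γ₂ * ζ : ℤ_[p]ˣ) : ℤ_[p]) = (cyclotomicGenerator p : ℤ_[p]))
    (Ω δ : ℂ) (Ωp : ℂ_[p]) (hΩ : Ω ≠ 0) (hΩp : Ωp ≠ 0)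
    (hδ : δ ^ 2 = (NumberField.discr K : ℂ) ∨ δ ^ 2 = -(NumberField.discr K : ℂ))
    (G : PowerSeries (PowerSeries (PadicComplexInt p)))
    (hG : IsKatzMeasure₂ ι v vbar S κ₁ κ₂ γ₁ γ₂ ψ⁻¹ Ω δ Ωp G) :
    ∃ (w : ℤ) (g : absoluteGaloisGroup K), (w = 1 ∨ w = -1) ∧
      ∀ (r r₂ : FramedGaloisRep K (PadicAlgCl p) 1),
        FactorsThroughPair κ₁ κ₂ r → FactorsThroughPair κ₁ κ₂ r₂ → IsConjInverse r r₂ →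
        ∀ x : ℂ_[p],
          IntSeries.HasValueAt₂ G (avatarValueAt r₂ γ₁ - 1) (avatarValueAt r₂ γ₂ - 1) x →
          IntSeries.HasValueAt₂ G (avatarValueAt r γ₁ - 1) (avatarValueAt r γ₂ - 1)
            ((w : ℂ_[p]) * avatarValueAt r g * x) := by
  sorry

/-- **`stub_frameSign` (v1/v2 stub, now PROVED from `stub_selfDual` by -p2's `stub_frameSign_of_selfDual`, p585046) — the
SIGN of the two-variable functional equation, read on the reduced frame (rung R1 «TangentSymmetry» of the route, in the
currency the algebra consumes).**  In the setting of the crux (all binders of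
`CycTangentBound` up to the frame hypothesis `hG`), with `k = 𝒪_{ℂ_p}/𝔪`, `ḡ ∈ k⟦T⟧` the reduction of the inner
(cyclotomic) line `G(0,T₂)` and `c̄ᵢⱼ` the residue of `[T₁^i T₂^j]G`: there are a sign `ε ∈ k`, `ε² = 1`, the
inversion `ι = (1+T)⁻¹ − 1` and a `1`-unit `V ∈ k⟦T⟧` with (a) `ḡ(ι(T)) = ε·V·ḡ` — the functional equation of the
cyclotomic line (`= unit · L_p(f_A, α)` by Rubin 1991 §12; Mazur–Tate–Teitelbaum §I.17, sign `ε̄ = w(A)`), and (b) the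
first-order companion OFF the line: if `c̄₀₀ = c̄₀₁ = 0` then `c̄₁₀ = ε·c̄₁₀` (complex conjugation ∘ de Shalit's
two-variable functional equation II.6.4 (9)/(14) acts on the cotangent plane of `𝔽̄_p⟦Γ⟧`, `Γ = Gal(K̃_∞/K) ≅ ℤ_p²`,
by an involution with eigenvalue `−1` on the cyclotomic direction; read modulo `(T₁,T₂)²` on the self-dual branch
`(ψ⁻¹)̌ = ψ⁻¹` of a curve over `ℚ`).  Inputs in print, not provable now: `DeShalit1987.thmII64_katzMeasure₂_functionalEquation`
(cite-only), self-duality of `ψ_A`, two-variable rigidity; part (a) alone: `Rubin1991.sec12_padicLFunction_eq_unit_mul_cyclotomicLine`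
(route item KatzFrameInputs) + tree theorem `subst_padicLFunction_eq_of_symmetry`.  Size L.
[deShalit1987 II.6.4; Rubin1991 §12; MazurTateTeitelbaum1986Invent §I.17] -/
theorem stub_frameSign
    (A : WeierstrassCurve ℚ) [A.IsElliptic] [A.IsGloballyMinimal] (p : ℕ) [Fact p.Prime]
    (hp : 5 ≤ p) (hj : A.j ∈ maximalCMJInvariants) (hgood : A.HasGoodReductionAtPrime p)
    (hord : ¬ (p : ℤ) ∣ A.frobeniusTrace p) (hirr : A.HasIrreducibleModPGaloisRep p)
    (K : Type) [Field K] [NumberField K] (hK : IsCMFieldOfJ K A.j)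
    (ψ : HeckeCharacter K) (hψ : ψ.HasInfinityType (fun _ ↦ 1) (fun _ ↦ 0))
    (hL : ∀ s : ℂ, 3 / 2 < s.re → heckeLFunction ψ s = A.LSeries s)
    (ι : PadicAlgCl p ≃+* ℂ) (v vbar : HeightOneSpectrum (𝓞 K))
    (hv : ((p : ℕ) : 𝓞 K) ∈ v.asIdeal) (hvbar : ((p : ℕ) : 𝓞 K) ∈ vbar.asIdeal) (hne : vbar ≠ v)
    (hι : ∀ (w : InfinitePlace K) (k : 𝓞 K), k ∈ v.asIdeal ↔ ‖ι.symm (w.embedding (k : K))‖ < 1)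
    (S : Finset (HeightOneSpectrum (𝓞 K))) (hvS : v ∉ S) (hvbS : vbar ∉ S)
    (hSram : ∀ w ∈ S, ¬ ψ.IsUnramifiedAt w)
    (hSunr : ∀ w : HeightOneSpectrum (𝓞 K), w ∉ S → ψ.IsUnramifiedAt w)
    (κ₁ κ₂ : ZpExtension K p) (γ₁ γ₂ : absoluteGaloisGroup K)
    (hpair : ZpExtension.IsTopGeneratorPair κ₁ κ₂ γ₁ γ₂) (hcyc : κ₂.IsCyclotomic)
    (hγ₂ : ∃ ζ : ℤ_[p]ˣ, IsOfFinOrder ζ ∧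
        ((GaloisRep.cyclotomicCharacter K p γ₂ * ζ : ℤ_[p]ˣ) : ℤ_[p]) = (cyclotomicGenerator p : ℤ_[p]))
    (Ω δ : ℂ) (Ωp : ℂ_[p]) (hΩ : Ω ≠ 0) (hΩp : Ωp ≠ 0)
    (hδ : δ ^ 2 = (NumberField.discr K : ℂ) ∨ δ ^ 2 = -(NumberField.discr K : ℂ))
    (G : PowerSeries (PowerSeries (PadicComplexInt p)))
    (hG : IsKatzMeasure₂ ι v vbar S κ₁ κ₂ γ₁ γ₂ ψ⁻¹ Ω δ Ωp G) :
    ∃ (ε : IsLocalRing.ResidueField (PadicComplexInt p))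
      (ιT V : PowerSeries (IsLocalRing.ResidueField (PadicComplexInt p))),
      ε ^ 2 = 1 ∧ (1 + PowerSeries.X) * (ιT + 1) = 1 ∧ PowerSeries.constantCoeff V = 1 ∧
      PowerSeries.subst ιT
          (PowerSeries.map (IsLocalRing.residue (PadicComplexInt p)) (PowerSeries.constantCoeff G)) =
        PowerSeries.C ε * V *
          PowerSeries.map (IsLocalRing.residue (PadicComplexInt p)) (PowerSeries.constantCoeff G) ∧
      (IsLocalRing.residue (PadicComplexInt p) (PowerSeries.coeff 0 (PowerSeries.coeff 0 G)) = 0 →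
        IsLocalRing.residue (PadicComplexInt p) (PowerSeries.coeff 1 (PowerSeries.coeff 0 G)) = 0 →
        IsLocalRing.residue (PadicComplexInt p) (PowerSeries.coeff 0 (PowerSeries.coeff 1 G)) =
          ε * IsLocalRing.residue (PadicComplexInt p) (PowerSeries.coeff 0 (PowerSeries.coeff 1 G))) :=
  Summit.BirchSwinnertonDyer.BirchSwinnertonDyer.Theorems.CycTangentCMCycTangentBoundFrameSignOfSelfDual.stub_frameSign_of_selfDual
    A p hp hj K hK κ₁ κ₂ γ₁ γ₂ hpair hcyc G
    (stub_selfDual A p hp hj hgood hord hirr K hK ψ hψ hL ι v vbar hv hvbar hne hι S hvS hvbS hSram hSunr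
      κ₁ κ₂ γ₁ γ₂ hpair hcyc hγ₂ Ω δ Ωp hΩ hΩp hδ G hG)

/-- **stub `stub_lowContact` — the tangent-cone inequality below contact order three (PURE ALGEBRA; proved by this
seat, LANDED p580618 `Theorems/CycTangentCMCycTangentBoundStubLowContact.lean`; restated here by name).**  Over any local ring `O` with `2 ∈ Oˣ`: given
the sign data of `stub_frameSign` for `G ∈ O⟦T₁⟧⟦T₂⟧`, if some coefficient of the inner line `G(0,T₂)` of degree
`≤ 3` is a unit then every unit coefficient `[T₁^i T₂^j]G` comes with a unit coefficient of `G(0,T₂)` in degree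
`≤ i+j+1`.  (Least unit degree `n₀ ≤ 3`; if `n₀ > i+j+1` then `i+j ≤ 1`; `i = 0` contradicts minimality;
`(i,j) = (1,0)` forces `n₀ = 3`, `ε = (−1)^3`, `c̄₁₀ = −c̄₁₀ = 0`.)  Size S. [folklore] -/
theorem stub_lowContact {O : Type*} [CommRing O] [IsLocalRing O] (h2 : IsUnit (2 : O))
    (G : PowerSeries (PowerSeries O))
    {ε : IsLocalRing.ResidueField O} {ι V : PowerSeries (IsLocalRing.ResidueField O)}
    (hι : (1 + PowerSeries.X) * (ι + 1) = 1) (hV : PowerSeries.constantCoeff V = 1)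
    (hFE : PowerSeries.subst ι
        (PowerSeries.map (IsLocalRing.residue O) (PowerSeries.constantCoeff G)) =
      PowerSeries.C ε * V * PowerSeries.map (IsLocalRing.residue O) (PowerSeries.constantCoeff G))
    (h10 : IsLocalRing.residue O (PowerSeries.coeff 0 (PowerSeries.coeff 0 G)) = 0 →
      IsLocalRing.residue O (PowerSeries.coeff 1 (PowerSeries.coeff 0 G)) = 0 →
      IsLocalRing.residue O (PowerSeries.coeff 0 (PowerSeries.coeff 1 G)) =
        ε * IsLocalRing.residue O (PowerSeries.coeff 0 (PowerSeries.coeff 1 G)))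
    (hlow : ∃ n ≤ 3, IsUnit (PowerSeries.coeff n (PowerSeries.constantCoeff G)))
    {i j : ℕ} (hij : IsUnit (PowerSeries.coeff j (PowerSeries.coeff i G))) :
    ∃ n ≤ i + j + 1, IsUnit (PowerSeries.coeff n (PowerSeries.constantCoeff G)) :=
  Summit.BirchSwinnertonDyer.BirchSwinnertonDyer.Theorems.CycTangentCMCycTangentBoundStubLowContact.stub_lowContact
    h2 G hι hV hFE h10 hlow hij

/-- **stub `stub_higherContact` — the OPEN content of the crux (rung R2 «HigherContact»): `λ̄_cyc ≤ m₀ + 1` at the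
frames whose inner (cyclotomic) line has NO unit coefficient in degree `≤ 3` (`λ(L_p(A)) ≥ 4`).**  Verbatim the crux
with the extra hypothesis `∀ n ≤ 3, [T₂ⁿ]G(0,T₂) ∉ 𝒪ˣ`.  No mechanism in print or in the route pins the cyclotomic
direction here (parity gives `c̄_{0,m₀+1-parity}` only); crux-sized; killed by ONE pair with `λ(L_p(A)) ≥ λ̄(ℓ) + 2`
for a second `ℤ_p`-line `ℓ` through `ψ⁻¹` (e.g. the anticyclotomic/BDP or Katz `𝔭`-power branch). [Greenberg1999
Conj. 1.11; Cuoco1982; Monsky1981] -/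
theorem stub_higherContact
    (A : WeierstrassCurve ℚ) [A.IsElliptic] [A.IsGloballyMinimal] (p : ℕ) [Fact p.Prime]
    (hp : 5 ≤ p) (hj : A.j ∈ maximalCMJInvariants) (hgood : A.HasGoodReductionAtPrime p)
    (hord : ¬ (p : ℤ) ∣ A.frobeniusTrace p) (hirr : A.HasIrreducibleModPGaloisRep p)
    (K : Type) [Field K] [NumberField K] (hK : IsCMFieldOfJ K A.j)
    (ψ : HeckeCharacter K) (hψ : ψ.HasInfinityType (fun _ ↦ 1) (fun _ ↦ 0))
    (hL : ∀ s : ℂ, 3 / 2 < s.re → heckeLFunction ψ s = A.LSeries s)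
    (ι : PadicAlgCl p ≃+* ℂ) (v vbar : HeightOneSpectrum (𝓞 K))
    (hv : ((p : ℕ) : 𝓞 K) ∈ v.asIdeal) (hvbar : ((p : ℕ) : 𝓞 K) ∈ vbar.asIdeal) (hne : vbar ≠ v)
    (hι : ∀ (w : InfinitePlace K) (k : 𝓞 K), k ∈ v.asIdeal ↔ ‖ι.symm (w.embedding (k : K))‖ < 1)
    (S : Finset (HeightOneSpectrum (𝓞 K))) (hvS : v ∉ S) (hvbS : vbar ∉ S)
    (hSram : ∀ w ∈ S, ¬ ψ.IsUnramifiedAt w)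
    (hSunr : ∀ w : HeightOneSpectrum (𝓞 K), w ∉ S → ψ.IsUnramifiedAt w)
    (κ₁ κ₂ : ZpExtension K p) (γ₁ γ₂ : absoluteGaloisGroup K)
    (hpair : ZpExtension.IsTopGeneratorPair κ₁ κ₂ γ₁ γ₂) (hcyc : κ₂.IsCyclotomic)
    (hγ₂ : ∃ ζ : ℤ_[p]ˣ, IsOfFinOrder ζ ∧
        ((GaloisRep.cyclotomicCharacter K p γ₂ * ζ : ℤ_[p]ˣ) : ℤ_[p]) = (cyclotomicGenerator p : ℤ_[p]))
    (Ω δ : ℂ) (Ωp : ℂ_[p]) (hΩ : Ω ≠ 0) (hΩp : Ωp ≠ 0)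
    (hδ : δ ^ 2 = (NumberField.discr K : ℂ) ∨ δ ^ 2 = -(NumberField.discr K : ℂ))
    (G : PowerSeries (PowerSeries (PadicComplexInt p)))
    (hG : IsKatzMeasure₂ ι v vbar S κ₁ κ₂ γ₁ γ₂ ψ⁻¹ Ω δ Ωp G)
    (hhigh : ∀ n ≤ 3, ¬ IsUnit (PowerSeries.coeff n (PowerSeries.constantCoeff G)))
    (i j : ℕ) (hij : IsUnit (PowerSeries.coeff j (PowerSeries.coeff i G))) :
    ∃ n : ℕ, n ≤ i + j + 1 ∧ IsUnit (PowerSeries.coeff n (PowerSeries.constantCoeff G)) := by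
  sorry

/-- `2` is a unit of `𝒪_{ℂ_p}` for `p ≠ 2` (`‖2‖_p = 1`). [folklore] -/
theorem isUnit_two_padicComplexInt (p : ℕ) [Fact p.Prime] (hp : p ≠ 2) :
    IsUnit (2 : PadicComplexInt p) := by
  rw [isUnit_padicComplexInt_iff]
  have h2 : ((2 : PadicComplexInt p) : ℂ_[p]) = algebraMap ℚ_[p] ℂ_[p] 2 := by
    rw [map_ofNat]; exact map_ofNat (PadicComplexInt p).subtype 2
  have hn : ‖algebraMap ℚ_[p] ℂ_[p] 2‖ = ‖(2 : ℚ_[p])‖ := by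
    rw [IsScalarTower.algebraMap_apply ℚ_[p] (PadicAlgCl p) ℂ_[p]]
    exact PadicComplex.norm_extends' p 2
  rw [h2, hn]
  have : ((2 : ℕ) : ℚ_[p]) = 2 := by norm_cast
  rw [← this, Padic.norm_natCast_eq_one_iff]
  exact (Nat.coprime_primes Fact.out Nat.prime_two).mpr hp

/-- **Composition (kernel-checked; the only `sorry`s are inside the three registered `stub_*` obligations, invoked BY
NAME): `stub_frameSign` + `stub_lowContact` settle every frame whose cyclotomic line has a unit coefficient in degree
`≤ 3`; `stub_higherContact` is the rest; together the ROUTE decl `CycTangentCM.CycTangentBound` by name.** -/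
theorem CycTangentBound_of :
    Summit.BirchSwinnertonDyer.BirchSwinnertonDyer.Theses.CycTangentCM.CycTangentBound := by
  intro A _ _ p _ hp hj hgood hord hirr K _ _ hK ψ hψ hL ι v vbar hv hvbar hne hι S hvS hvbS hSram hSunr
    κ₁ κ₂ γ₁ γ₂ hpair hcyc hγ₂ Ω δ Ωp hΩ hΩp hδ G hG i j hij
  by_cases hlow : ∃ n ≤ 3, IsUnit (PowerSeries.coeff n (PowerSeries.constantCoeff G))
  · obtain ⟨ε, ιT, V, -, hιT, hV, hFE, h10⟩ := stub_frameSign A p hp hj hgood hord hirr K hK ψ hψ hL ι v vbar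
      hv hvbar hne hι S hvS hvbS hSram hSunr κ₁ κ₂ γ₁ γ₂ hpair hcyc hγ₂ Ω δ Ωp hΩ hΩp hδ G hG
    exact stub_lowContact (isUnit_two_padicComplexInt p (by omega)) G hιT hV hFE h10 hlow hij
  · push Not at hlow
    exact stub_higherContact A p hp hj hgood hord hirr K hK ψ hψ hL ι v vbar hv hvbar hne hι S hvS hvbS hSram
      hSunr κ₁ κ₂ γ₁ γ₂ hpair hcyc hγ₂ Ω δ Ωp hΩ hΩp hδ G hG hlow i j hij

end Summit.BirchSwinnertonDyer.BirchSwinnertonDyer.Cruxes.CycTangentBound.TangentConeParity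

end
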